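import Literature.NumberTheory.Sieve.LargestPrimeFactorCubicS1Decomp
import Summits.Parity.BatemanHorn.Theorems.SoloInformedLocatedFamilyCriterion
import HarnessLib

/-!
# Heath-Brown's UNSIEVED family of `n³ + 2` injects into located root pairs

[this work]  Three levels of the located-root count
`Mid(x) = polyLocatedRootCount (X³+2) x = #{(n, e) : n ≤ x, e ∣ n³+2, x < e, e² < n³+2}`
(`∑_{n ≤ x} τ(n³+2) = 2A x log x + 2 Mid(x) + O(x)`, `A = rootLevelConst (X³+2)`,
`SoloInformedRootCountLevel`):

* (a) `Mid(x) ≥ c x log log x` — unconditional (`SoloInformedLocatedRootLogLog`);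
* (b) `lim inf Mid(x)/(x log x) > 0` — THIS FILE reduces it to the two unsieved inputs of
  Heath-Brown's proof [Heath-Brown 2001, *The largest prime factor of `X³+2`*, PLMS 82, §2
  pp. 559–562, (5.1) p. 571, §5 pp. 571–574];
* (c) `Mid(x) ∼ ½·A·x log x` (Erdős's constant for a cubic) — open.

THE FAMILY.  With the tree's objects of `LargestPrimeFactorCubicSetup` (`Y` = Heath-Brown's `X`,
`δ = hbδ = 1/321`): `pairsVP Y P` = the pairs `(α, p)`, `α = a + b∛2 + c∛4 ∈ gens Y P` a generator
with `Y^{1+3δ/2} < N(α) < Y^{1+2δ}` (`normNat_bounds_of_mem_gens`), `p ∈ 𝒦` a prime in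
`(Y^{3δ}, Y^{4δ}]` dividing `N(α)`; `Acount Y α = #{Y < n ≤ 2Y : (α) ∋ n + ∛2}`;
`Rv Y α = Acount − Y/N(α)`.  The UNSIEVED count (no `λ_d`, i.e. `λ_d ↦ [d = 1]`)

  `𝒩(Y) = ∑_{(α,p)} #𝒜_{(α)} = Y·𝔐(Y) + ℛ(Y)`,  `𝔐 = ∑_{(α,p)} 1/N(α)`,  `ℛ = ∑_{(α,p)} R_α`

(`hbUnsievedCount_eq`).  Each counted `(n, (α, p))` gives the located pair `(n, N(α))` of `n³ + 2`:
`N(α) ∣ n³ + 2` (`absNorm_dvd_of_natCast_add_θint_mem`), `N(α) > Y^{1+3δ/2} ≥ x` for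
`x ≤ Y^{1+3δ/2}`, `N(α)² < Y^{2+4δ} ≤ Y³ < n³ + 2`; `(α)` is determined by `(n, N(α))` (Heath-Brown's
Lemma 1, `eq_of_natCast_add_θint_mem_of_absNorm_eq` + `gens_injective`) and `p` by `p ∣ N(α)`,
`p > Y^{3δ}`, `N(α) < Y^{1+2δ} ≤ Y^{324δ}` up to multiplicity `107`.  Hence

* `hbUnsievedCount_le_polyLocatedRootCount` — `𝒩(Y) ≤ 107 · Mid(x)` for `2Y ≤ x ≤ Y^{1+3δ/2}`;
* `abs_hbUnsievedRem_le` — `|ℛ(Y)|` is majorised by the `d = 1` block of the tree's (5.1)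
  (`LargestPrimeFactorCubicS1Decomp.abs_S1sum_le`), the quantity Heath-Brown's §5 bounds by
  `≪ Y^{1−ε}` (p. 573: the bound for (5.1) is proved with absolute values outside the `c`-sum and
  summed over ALL sieve divisors INCLUDING `d = 1`; Ermoshin, arXiv:2602.03642 §4, does the same for
  every monic irreducible cubic);
* `exists_eventually_mul_log_le_polyLocatedRootCount_cubic_of_unsieved` — **the reduction**:
  `[∃A ∀ᶠY |ℛ(Y)| ≤ A·Y] ∧ [∃c>0 ∀ᶠY 𝔐(Y) ≥ c·log Y] ⟹ ∃c'>0 ∀ᶠx c'·x·log x ≤ Mid(x)`, for any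
  admissible choice `P Y i ⊆ basePairs Y i` of Heath-Brown's pairs `(a, b)`; and the Erdős form
  `exists_eventually_erdos_gt_of_unsieved`: `∑_{n ≤ x} τ(n³+2) ≥ (2A + c') x log x` eventually.

STATUS OF THE TWO INPUTS (not proved here, not stated as theorems in print): the remainder bound is
the `λ_d ↦ [d=1]` specialisation of Heath-Brown's Lemma 5 / §5 (in the tree: the Kloosterman-sum
route `LargestPrimeFactorCubicS1*`, final summation not yet landed); the mass bound
`𝔐(Y) ≥ c log Y` is the unsieved form of his Lemmas 10–11, §§6–8 (`≍ (#scales ≍ log Y) ×` const per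
dyadic cube; tree: `LargestPrimeFactorCubicS0*`, sieved).  With both, level (b) follows; level (c)
needs the located mass on the whole range `(x, x^{3/2})`, which no factorable family reaches.
No path to the Bateman–Horn conjunct is claimed (storey below the parity wall).
-/

noncomputable section

open Finset Real Filter Polynomial NumberField
open Literature.NumberTheory.Sieve.LargestPrimeFactorCubic
open Literature.NumberTheory.LFunctions.CubeRootTwoField

namespace Summit.Parity.BatemanHorn.Theorems

/-! ### The unsieved count, mass and remainder -/

/-- `𝒩(Y) = ∑_{(α,p)} #𝒜_{(α)}` — Heath-Brown's `S` with the sieve weight replaced by `1`.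
[cite: HeathBrown2001LargestPrimeFactorCubic, §2 p. 561] -/
def hbUnsievedCount (Y : ℕ) (P : ℕ → Finset (ℕ × ℕ)) : ℝ :=
  ∑ vp ∈ pairsVP Y P, (Acount Y vp.1 : ℝ)

/-- `𝔐(Y) = ∑_{(α,p)} 1/N(α)` — the unsieved mass (Heath-Brown's `S₀` with `λ_d ↦ [d = 1]`).
[cite: HeathBrown2001LargestPrimeFactorCubic, §2 p. 561] -/
def hbUnsievedMain (Y : ℕ) (P : ℕ → Finset (ℕ × ℕ)) : ℝ :=
  ∑ vp ∈ pairsVP Y P, (1 : ℝ) / normNat vp.1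

/-- `ℛ(Y) = ∑_{(α,p)} R_α` — the unsieved remainder (Heath-Brown's `S₁` with `λ_d ↦ [d = 1]`).
[cite: HeathBrown2001LargestPrimeFactorCubic, §2 p. 561] -/
def hbUnsievedRem (Y : ℕ) (P : ℕ → Finset (ℕ × ℕ)) : ℝ :=
  ∑ vp ∈ pairsVP Y P, Rv Y vp.1

/-- `𝒩(Y) = Y·𝔐(Y) + ℛ(Y)`. [this work] -/
theorem hbUnsievedCount_eq (Y : ℕ) (P : ℕ → Finset (ℕ × ℕ)) :
    hbUnsievedCount Y P = Y * hbUnsievedMain Y P + hbUnsievedRem Y P := by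
  rw [hbUnsievedCount, hbUnsievedMain, hbUnsievedRem, mul_sum, ← sum_add_distrib]
  refine sum_congr rfl (fun vp _ => ?_)
  rw [Rv]
  ring

/-- Membership in `pairsVP`, unfolded. [folklore] -/
theorem hb_of_mem_pairsVP {Y : ℕ} {P : ℕ → Finset (ℕ × ℕ)} {vp : (ℕ × ℕ × ℕ) × ℕ}
    (h : vp ∈ pairsVP Y P) : vp.1 ∈ gens Y P ∧ vp.2 ∈ kPrimes Y ∧ vp.2 ∣ normNat vp.1 := by
  rw [pairsVP, mem_filter, mem_product] at h
  exact ⟨h.1.1, h.1.2, h.2⟩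

/-! ### The remainder is the `d = 1` block of (5.1) -/

/-- **`|ℛ(Y)| ≤` the `d = 1` block of (5.1)**: [this work]
`|ℛ| ≤ ∑_{p ∈ 𝒦} ∑_i ∑_{(a,b)} ∑_{j ∈ roots(p·1)} |∑_{c : p ∣ a + bj + cj²} R_{(a,b,c)}|` — literally the
summand of `abs_S1sum_le` at the sieve divisor `d = 1` (where `|λ_1| = 1`), reorganised exactly as
in `S1sum_eq`. [cite: HeathBrown2001LargestPrimeFactorCubic, (5.1)] -/
theorem abs_hbUnsievedRem_le {Y : ℕ} {P : ℕ → Finset (ℕ × ℕ)} (hP : ∀ i, P i ⊆ basePairs Y i) :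
    |hbUnsievedRem Y P| ≤ ∑ p ∈ kPrimes Y, ∑ i ∈ scales Y, ∑ ab ∈ P i, ∑ j ∈ roots (p * 1),
        |∑ c ∈ (cSet (tscale Y i) ab.1 ab.2).filter
          (fun c : ℕ => ((p * 1 : ℕ) : ℤ) ∣ (ab.1 : ℤ) + ab.2 * j + (c : ℤ) * (j : ℤ) ^ 2),
          Rv Y (ab.1, ab.2, c)| := by
  classical
  have h1 : hbUnsievedRem Y P =
      ∑ vp ∈ (pairsVP Y P).filter (fun vp => 1 ∣ normNat vp.1 / vp.2), Rv Y vp.1 := by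
    rw [hbUnsievedRem]
    symm
    refine sum_subset
      (filter_subset (fun vp : (ℕ × ℕ × ℕ) × ℕ => 1 ∣ normNat vp.1 / vp.2) (pairsVP Y P)) ?_
    intro vp hvp hn
    exact (hn (mem_filter.2 ⟨hvp, one_dvd _⟩)).elim
  have h2 : hbUnsievedRem Y P = ∑ p ∈ kPrimes Y, ∑ i ∈ scales Y, ∑ ab ∈ P i, ∑ j ∈ roots (p * 1),
      ∑ c ∈ (cSet (tscale Y i) ab.1 ab.2).filter
        (fun c : ℕ => ((p * 1 : ℕ) : ℤ) ∣ (ab.1 : ℤ) + ab.2 * j + (c : ℤ) * (j : ℤ) ^ 2),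
        Rv Y (ab.1, ab.2, c) := by
    rw [h1, sum_pairsVP_filter_eq]
    refine sum_congr rfl (fun p hp => ?_)
    have hp0 : 0 < p := (mem_kPrimes hp).1.pos
    rw [sum_gens_filter_eq hP]
    refine sum_congr rfl (fun i hi => sum_congr rfl (fun ab hab => ?_))
    exact sum_cSet_filter_dvd_eq hP hi hab (Nat.mul_pos hp0 Nat.one_pos)
      (fun c => Rv Y (ab.1, ab.2, c))
  rw [h2]
  refine (abs_sum_le_sum_abs _ _).trans (sum_le_sum (fun p _ => ?_))
  refine (abs_sum_le_sum_abs _ _).trans (sum_le_sum (fun i _ => ?_))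
  refine (abs_sum_le_sum_abs _ _).trans (sum_le_sum (fun ab _ => ?_))
  exact abs_sum_le_sum_abs _ _

/-! ### The unsieved count as a count of located pairs -/

open scoped Classical in
/-- `𝒩(Y) = ∑_{Y < n ≤ 2Y} #{(α, p) : (α) ∋ n + ∛2}` (double counting). [this work] -/
theorem hbUnsievedCount_eq_sum_card (Y : ℕ) (P : ℕ → Finset (ℕ × ℕ)) :
    hbUnsievedCount Y P = ∑ n ∈ Ioc Y (2 * Y),
      (#((pairsVP Y P).filter fun vp => (n : 𝓞 K) + θint ∈ genIdeal vp.1) : ℝ) := by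
  have h := sum_card_bipartiteAbove_eq_sum_card_bipartiteBelow (s := pairsVP Y P)
    (t := Ioc Y (2 * Y))
    (r := fun (vp : (ℕ × ℕ × ℕ) × ℕ) (n : ℕ) => ((n : ℕ) : 𝓞 K) + θint ∈ genIdeal vp.1)
  simp only [bipartiteAbove, bipartiteBelow] at h
  rw [hbUnsievedCount]
  simp only [Acount]
  exact_mod_cast h

/-- **Multiplicity `≤ 107` in `p`**: at most `107` primes of `𝒦` (`> Y^{3δ}`) divide `N(α) < Y^{1+2δ}`
(`1 + 2δ ≤ 324δ = 3δ·108`). [this work] -/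
theorem card_kPrimes_filter_dvd_le {Y : ℕ} {P : ℕ → Finset (ℕ × ℕ)}
    (hP : ∀ i, P i ⊆ basePairs Y i) (hY : 1 ≤ Y) {v : ℕ × ℕ × ℕ} (hv : v ∈ gens Y P) :
    #((kPrimes Y).filter (· ∣ normNat v)) ≤ 107 := by
  have hY1 : (1 : ℝ) ≤ Y := by exact_mod_cast hY
  have hY0 : (0 : ℝ) < Y := by linarith
  have h108 : (Y : ℝ) ^ (1 + 2 * hbδ) ≤ ((Y : ℝ) ^ (3 * hbδ)) ^ (107 + 1) := by
    rw [← Real.rpow_mul_natCast hY0.le]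
    refine Real.rpow_le_rpow_of_exponent_le hY1 ?_
    unfold hbδ
    push_cast
    norm_num
  refine card_le_of_prime_dvd (Real.one_le_rpow hY1 (by linarith [hbδ_pos]))
    (normNat_pos_of_mem_gens hP hv).ne' ?_ ((normNat_bounds_of_mem_gens hP hv).2.trans_le h108)
  intro p hp
  rw [mem_filter] at hp
  obtain ⟨hpP, hp1, -⟩ := mem_kPrimes hp.1
  exact ⟨hpP, hp1, hp.2⟩

open scoped Classical in
/-- **Multiplicity of the norm**: among the pairs `(α, p)` with `(α) ∋ n + ∛2`, at most `107` have a
given `N(α)` — `(α)` is determined by `n` and `N(α)` (Heath-Brown's Lemma 1 + distinctness of the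
generators), `p` up to `107` choices. [this work] -/
theorem card_pairsVP_fibre_le {Y : ℕ} {P : ℕ → Finset (ℕ × ℕ)} (hP : ∀ i, P i ⊆ basePairs Y i)
    (hY : 1 ≤ Y) (n : ℕ) {vp₀ : (ℕ × ℕ × ℕ) × ℕ}
    (hvp₀ : vp₀ ∈ (pairsVP Y P).filter fun vp => (n : 𝓞 K) + θint ∈ genIdeal vp.1) :
    #(((pairsVP Y P).filter fun vp => (n : 𝓞 K) + θint ∈ genIdeal vp.1).filter
        fun vp => normNat vp.1 = normNat vp₀.1) ≤ 107 := by
  set T := (pairsVP Y P).filter fun vp => (n : 𝓞 K) + θint ∈ genIdeal vp.1 with hT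
  have hmemT : ∀ vp ∈ T, vp.1 ∈ gens Y P ∧ vp.2 ∈ kPrimes Y ∧ vp.2 ∣ normNat vp.1 ∧
      (n : 𝓞 K) + θint ∈ genIdeal vp.1 := by
    intro vp hvp
    have h := mem_filter.1 hvp
    obtain ⟨h1, h2, h3⟩ := hb_of_mem_pairsVP h.1
    exact ⟨h1, h2, h3, h.2⟩
  obtain ⟨hv₀, -, -, hmem₀⟩ := hmemT vp₀ hvp₀
  have hfst : ∀ vp ∈ T.filter (fun vp => normNat vp.1 = normNat vp₀.1), vp.1 = vp₀.1 := by
    intro vp hvp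
    have h := mem_filter.1 hvp
    obtain ⟨hv, -, -, hmem⟩ := hmemT vp h.1
    have hJ : genIdeal vp.1 = genIdeal vp₀.1 :=
      eq_of_natCast_add_θint_mem_of_absNorm_eq hmem hmem₀
        (by rw [absNorm_genIdeal, absNorm_genIdeal, h.2])
    exact gens_injective hP hv hv₀ hJ
  have hmaps : Set.MapsTo (fun vp : (ℕ × ℕ × ℕ) × ℕ => vp.2)
      ↑(T.filter fun vp => normNat vp.1 = normNat vp₀.1)
      ↑((kPrimes Y).filter (· ∣ normNat vp₀.1)) := by
    intro vp hvp
    have h := mem_filter.1 (Finset.mem_coe.1 hvp)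
    obtain ⟨-, hp, hpd, -⟩ := hmemT vp h.1
    refine Finset.mem_coe.2 (mem_filter.2 ⟨hp, ?_⟩)
    have he : normNat vp.1 = normNat vp₀.1 := h.2
    rw [← he]
    exact hpd
  have hinj : Set.InjOn (fun vp : (ℕ × ℕ × ℕ) × ℕ => vp.2)
      ↑(T.filter fun vp => normNat vp.1 = normNat vp₀.1) := by
    intro vp hvp vp' hvp' h
    exact Prod.ext ((hfst vp (Finset.mem_coe.1 hvp)).trans (hfst vp' (Finset.mem_coe.1 hvp')).symm) h
  calc #(T.filter fun vp => normNat vp.1 = normNat vp₀.1)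
      ≤ #((kPrimes Y).filter (· ∣ normNat vp₀.1)) := card_le_card_of_injOn _ hmaps hinj
    _ ≤ 107 := card_kPrimes_filter_dvd_le hP hY hv₀

/-- `|(X³+2)(n)| = n³ + 2` for `n ∈ ℕ`. [folklore] -/
theorem natAbs_eval_X_pow_three_add_two (n : ℕ) :
    ((X ^ 3 + C 2 : ℤ[X]).eval (n : ℤ)).natAbs = n ^ 3 + 2 := by
  have h : ((X ^ 3 + C 2 : ℤ[X]).eval (n : ℤ)) = (n : ℤ) ^ 3 + 2 := by simp
  rw [h, show ((n : ℤ) ^ 3 + 2 : ℤ) = ((n ^ 3 + 2 : ℕ) : ℤ) by push_cast; ring, Int.natAbs_natCast]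

open scoped Classical in
/-- **`𝒩(Y) ≤ 107 · Mid(x)` for `2Y ≤ x ≤ Y^{1+3δ/2}`** — the unsieved family injects into the located
root pairs of `n³ + 2` with multiplicity `≤ 107`. [this work] -/
theorem hbUnsievedCount_le_polyLocatedRootCount {Y : ℕ} {P : ℕ → Finset (ℕ × ℕ)}
    (hP : ∀ i, P i ⊆ basePairs Y i) (hY : 1 ≤ Y) {x : ℕ} (hx1 : 2 * Y ≤ x)
    (hx2 : (x : ℝ) ≤ (Y : ℝ) ^ (1 + 3 * hbδ / 2)) :
    hbUnsievedCount Y P ≤ 107 * (polyLocatedRootCount (X ^ 3 + C 2) x : ℝ) := by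
  have hY1 : (1 : ℝ) ≤ Y := by exact_mod_cast hY
  have hY0 : (0 : ℝ) < Y := by linarith
  have hsub : Ioc Y (2 * Y) ⊆ Icc 1 x := by
    intro n hn
    rw [mem_Ioc] at hn
    rw [mem_Icc]
    omega
  have hgens : ∀ n : ℕ, ∀ vp ∈ (pairsVP Y P).filter (fun vp => (n : 𝓞 K) + θint ∈ genIdeal vp.1),
      vp.1 ∈ gens Y P ∧ (n : 𝓞 K) + θint ∈ genIdeal vp.1 := by
    intro n vp hvp
    have h := mem_filter.1 hvp
    exact ⟨(hb_of_mem_pairsVP h.1).1, h.2⟩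
  have hdvd : ∀ n ∈ Ioc Y (2 * Y),
      ∀ vp ∈ (pairsVP Y P).filter (fun vp => (n : 𝓞 K) + θint ∈ genIdeal vp.1),
        normNat vp.1 ∣ ((X ^ 3 + C 2 : ℤ[X]).eval (n : ℤ)).natAbs := by
    intro n _ vp hvp
    rw [natAbs_eval_X_pow_three_add_two, ← absNorm_genIdeal]
    exact absNorm_dvd_of_natCast_add_θint_mem (hgens n vp hvp).2
  have hgt : ∀ n ∈ Ioc Y (2 * Y),
      ∀ vp ∈ (pairsVP Y P).filter (fun vp => (n : 𝓞 K) + θint ∈ genIdeal vp.1),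
        x < normNat vp.1 := by
    intro n _ vp hvp
    exact_mod_cast hx2.trans_lt (normNat_bounds_of_mem_gens hP (hgens n vp hvp).1).1
  have hsq : ∀ n ∈ Ioc Y (2 * Y),
      ∀ vp ∈ (pairsVP Y P).filter (fun vp => (n : 𝓞 K) + θint ∈ genIdeal vp.1),
        normNat vp.1 * normNat vp.1 < ((X ^ 3 + C 2 : ℤ[X]).eval (n : ℤ)).natAbs := by
    intro n hn vp hvp
    rw [mem_Ioc] at hn
    rw [natAbs_eval_X_pow_three_add_two]
    have hN2 := (normNat_bounds_of_mem_gens hP (hgens n vp hvp).1).2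
    have he0 : (0 : ℝ) ≤ normNat vp.1 := Nat.cast_nonneg _
    have h1 : (normNat vp.1 : ℝ) * normNat vp.1 <
        (Y : ℝ) ^ (1 + 2 * hbδ) * (Y : ℝ) ^ (1 + 2 * hbδ) := mul_lt_mul'' hN2 hN2 he0 he0
    have h2 : (Y : ℝ) ^ (1 + 2 * hbδ) * (Y : ℝ) ^ (1 + 2 * hbδ) ≤ (Y : ℝ) ^ (3 : ℕ) := by
      rw [← Real.rpow_add hY0, ← Real.rpow_natCast]
      exact Real.rpow_le_rpow_of_exponent_le hY1 (by unfold hbδ; norm_num)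
    have h3 : (Y : ℝ) ^ (3 : ℕ) ≤ (n : ℝ) ^ (3 : ℕ) := by
      have : (Y : ℝ) ≤ n := by exact_mod_cast hn.1.le
      exact pow_le_pow_left₀ hY0.le this 3
    have h4 : (normNat vp.1 : ℝ) * normNat vp.1 < (n : ℝ) ^ 3 + 2 := by linarith
    exact_mod_cast h4
  have hfib : ∀ n ∈ Ioc Y (2 * Y),
      ∀ vp₀ ∈ (pairsVP Y P).filter (fun vp => (n : 𝓞 K) + θint ∈ genIdeal vp.1),
        #(((pairsVP Y P).filter fun vp => (n : 𝓞 K) + θint ∈ genIdeal vp.1).filter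
          fun vp => normNat vp.1 = normNat vp₀.1) ≤ 107 := by
    intro n _ vp₀ hvp₀
    exact card_pairsVP_fibre_le hP hY n hvp₀
  -- all implicit arguments are supplied: without them the elaborator unfolds the tree's
  -- definitions while matching `hdvd` (whnf timeout).
  have h := sum_card_le_mul_polyLocatedRootCount (ι := (ℕ × ℕ × ℕ) × ℕ) (X ^ 3 + C 2 : ℤ[X])
    (x := x) (m := 107) (S := Ioc Y (2 * Y)) hsub
    (fun n => (pairsVP Y P).filter fun vp => (n : 𝓞 K) + θint ∈ genIdeal vp.1)
    (fun vp => normNat vp.1) hdvd hgt hsq hfib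
  rw [hbUnsievedCount_eq_sum_card]
  exact_mod_cast h

/-! ### The reduction -/

/-- **Level (b) ⇐ the two unsieved inputs of Heath-Brown's proof.** [this work]  For any admissible
choice of pairs `P Y i ⊆ basePairs Y i`: if the unsieved remainder is `O(Y)` (Heath-Brown §5 gives
`O(Y^{1−ε})` for it, `ε > 0`) and the unsieved mass is `≥ c log Y` (his §§6–8 without the sieve
weights), then `Mid_{X³+2}(x) ≥ c' x log x` eventually. -/
theorem exists_eventually_mul_log_le_polyLocatedRootCount_cubic_of_unsieved
    {P : ℕ → ℕ → Finset (ℕ × ℕ)} (hP : ∀ Y i, P Y i ⊆ basePairs Y i)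
    (hrem : ∃ A : ℝ, ∀ᶠ Y : ℕ in atTop, |hbUnsievedRem Y (P Y)| ≤ A * Y)
    (hmain : ∃ c : ℝ, 0 < c ∧ ∀ᶠ Y : ℕ in atTop, c * Real.log Y ≤ hbUnsievedMain Y (P Y)) :
    ∃ c : ℝ, 0 < c ∧ ∀ᶠ x : ℕ in atTop,
      c * x * Real.log x ≤ (polyLocatedRootCount (X ^ 3 + C 2) x : ℝ) := by
  obtain ⟨A, hA⟩ := hrem
  obtain ⟨c, hc, hcm⟩ := hmain
  have hMid : ∀ᶠ Y : ℕ in atTop, ∀ x : ℕ, 2 * Y ≤ x → (x : ℝ) ≤ (Y : ℝ) ^ (1 + 3 * hbδ / 2) →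
      hbUnsievedCount Y (P Y) ≤ 107 * (polyLocatedRootCount (X ^ 3 + C 2) x : ℝ) := by
    filter_upwards [eventually_ge_atTop 1] with Y hY x hx1 hx2
    exact hbUnsievedCount_le_polyLocatedRootCount (hP Y) hY hx1 hx2
  exact exists_eventually_mul_log_le_of_family
    (Mid := fun x => (polyLocatedRootCount (X ^ 3 + C 2) x : ℝ))
    (N := fun Y => hbUnsievedCount Y (P Y)) (M := fun Y => hbUnsievedMain Y (P Y))
    (R := fun Y => hbUnsievedRem Y (P Y)) (κ := 3 * hbδ / 2) (m := 107)
    (by linarith [hbδ_pos]) (by norm_num) hc (fun Y => hbUnsievedCount_eq Y (P Y)) hMid hA hcm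

/-- **Erdős form.** [this work]  Under the same two inputs,
`∑_{n ≤ x} τ(n³+2) ≥ (2A + c') x log x` eventually (`A = rootLevelConst (X³+2)`), i.e.
`lim inf ∑_{n ≤ x} τ(n³+2) / (x log x) > 2A`: the located divisors of `n³ + 2` contribute a positive
proportion of Erdős's sum. -/
theorem exists_eventually_erdos_gt_of_unsieved
    {P : ℕ → ℕ → Finset (ℕ × ℕ)} (hP : ∀ Y i, P Y i ⊆ basePairs Y i)
    (hrem : ∃ A : ℝ, ∀ᶠ Y : ℕ in atTop, |hbUnsievedRem Y (P Y)| ≤ A * Y)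
    (hmain : ∃ c : ℝ, 0 < c ∧ ∀ᶠ Y : ℕ in atTop, c * Real.log Y ≤ hbUnsievedMain Y (P Y)) :
    ∃ c : ℝ, 0 < c ∧ ∀ᶠ x : ℕ in atTop,
      (2 * rootLevelConst (X ^ 3 + C 2 : ℤ[X]) + c) * x * Real.log x ≤
        (polyDivisorSum (X ^ 3 + C 2) x : ℝ) := by
  obtain ⟨c, hc, hev⟩ :=
    exists_eventually_mul_log_le_polyLocatedRootCount_cubic_of_unsieved hP hrem hmain
  exact ⟨c, hc, eventually_mul_log_le_polyDivisorSum_of_located irreducible_X_pow_three_add_two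
    (by rw [natDegree_X_pow_add_C]; norm_num) hc hev⟩

end Summit.Parity.BatemanHorn.Theorems
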